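import Literature.NumberTheory.Sieve.DrappeauDispersionS1Xi
import HarnessLib

/-!
# Drappeau 2017, §5.5: the `h`-sum of `ℛ₁'(q₀,n₀)` as a `ξ`-integral

Topic `Literature/NumberTheory/Sieve`, part of the formalisation of §5 of S. Drappeau, Proc. London
Math. Soc. (3) 114 (2017) 684–732 = arXiv:1504.05549 (Theorem 5.1 = the named fact
`Literature.NumberTheory.Sieve.Drappeau2017_theorem51`).  Everything here is PROVED; no definition
and no named fact is introduced.

§5.5 (arXiv p. 20): inserting `α̂(h/W) = W∫α(Wξ)e(−hξ)dξ` in `ℛ₁'` turns, for every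
`(q₁,q₂,n₁,n₂)`, the frequency sum `(1/W) ∑_h α̂(h/W) Φ(h)` into
`∫ ∑_h α(Wξ) e(−hξ) Φ(h) dξ`.  In the tree's normalisation (`α(m) = ψ(m/M)`,
`ψ = BFI.bumpC 1 (1/2)`):

* `Drappeau2017.integrable_fourierChar_mul_bumpC_scaled` — `ξ ↦ e(−hξ) ψ(Wξ/M)` is integrable;
* `Drappeau2017.mul_hsum_fourier_eq_integral` —
  `(M/W) ∑_{h∈S} 1_{W∤h} ψ̂(Mh/W) Φ(h) = ∫ ∑_{h∈S} 1_{W∤h} e(−hξ) ψ(Wξ/M) Φ(h) dξ`.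

## References

* S. Drappeau, Proc. London Math. Soc. (3) 114 (2017) 684–732, arXiv:1504.05549, §5.5, (5.23).
  [cite: Drappeau2017, §5.5]
-/

noncomputable section

open Real Complex MeasureTheory Finset
open scoped FourierTransform

namespace Literature.NumberTheory.Sieve

namespace Drappeau2017

/-- `ξ ↦ e(−hξ) ψ(Wξ/M) Φ` is integrable (`ψ = BFI.bumpC 1 (1/2)`, `M, W > 0`). [folklore] -/
theorem integrable_fourierChar_mul_bumpC_scaled {M W : ℝ} (hM : 0 < M) (hW : 0 < W) (h : ℝ) (c : ℂ) :
    Integrable (fun ξ : ℝ => (𝐞 (-(ξ * h)) : ℂ) * BFI.bumpC 1 (1 / 2) (W * ξ / M) * c) := by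
  have hcont : Continuous (fun ξ : ℝ => (𝐞 (-(ξ * h)) : ℂ) * BFI.bumpC 1 (1 / 2) (W * ξ / M) * c) := by
    refine ((Continuous.comp continuous_subtype_val
      (Real.continuous_fourierChar.comp ((continuous_id.mul continuous_const).neg))).mul ?_).mul
      continuous_const
    exact (BFI.contDiff_bumpC 1 (1 / 2)).continuous.comp
      ((continuous_const.mul continuous_id).div_const _)
  refine hcont.integrable_of_hasCompactSupport ?_
  -- support inside `[M/(2W) · 1, …]`: `ψ(Wξ/M) = 0` unless `1/2 < Wξ/M < 5/2`
  refine HasCompactSupport.intro (isCompact_Icc (a := (1 / 2 : ℝ) * M / W) (b := (5 / 2 : ℝ) * M / W))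
    fun ξ hξ => ?_
  rw [Set.mem_Icc, not_and_or, not_le, not_le] at hξ
  have hz : BFI.bumpC 1 (1 / 2) (W * ξ / M) = 0 := by
    refine BFI.bumpC_eq_zero (by norm_num) zero_le_one ?_
    rcases hξ with hξ | hξ
    · left
      rw [div_le_iff₀ hM]
      have : W * ξ < (1 / 2 : ℝ) * M := by
        rw [lt_div_iff₀ hW] at hξ; linarith [hξ]
      linarith
    · right
      rw [le_div_iff₀ hM]
      have : (5 / 2 : ℝ) * M < W * ξ := by
        rw [div_lt_iff₀ hW] at hξ; linarith [hξ]
      linarith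
  change (𝐞 (-(ξ * h)) : ℂ) * BFI.bumpC 1 (1 / 2) (W * ξ / M) * c = 0
  rw [hz, mul_zero, zero_mul]

/-- **The `h`-sum as a `ξ`-integral**: for `M, W > 0` and any `Φ`,
`(M/W) ∑_{h∈S} 1_{W∤h} ψ̂(Mh/W) Φ(h) = ∫ ∑_{h∈S} 1_{W∤h} e(−hξ) ψ(Wξ/M) Φ(h) dξ`
(`ψ = BFI.bumpC 1 (1/2)`). [cite: Drappeau2017, §5.5] -/
theorem mul_hsum_fourier_eq_integral {M : ℝ} (hM : 0 < M) {W : ℕ} (hW : 0 < W) (S : Finset ℤ)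
    (Φ : ℤ → ℂ) :
    ((M : ℂ) / (W : ℂ)) * ∑ h ∈ S, (if (W : ℤ) ∣ h then 0 else
        𝓕 (BFI.bumpC 1 (1 / 2)) (M * h / W) * Φ h) =
      ∫ ξ : ℝ, ∑ h ∈ S, (if (W : ℤ) ∣ h then 0 else
        (𝐞 (-(ξ * h)) : ℂ) * BFI.bumpC 1 (1 / 2) (W * ξ / M) * Φ h) := by
  have hWr : (0 : ℝ) < W := by exact_mod_cast hW
  rw [integral_finsetSum _ (fun h _ => ?_)]
  · rw [Finset.mul_sum]
    refine Finset.sum_congr rfl fun h _ => ?_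
    by_cases hd : (W : ℤ) ∣ h
    · simp [hd]
    · rw [if_neg hd]
      simp only [if_neg hd]
      rw [integral_mul_const, ← mul_assoc]
      have key := mul_fourier_eq_integral_scaled (BFI.bumpC 1 (1 / 2)) hM hWr (h : ℝ)
      have e : ((M / (W : ℝ) : ℝ) : ℂ) = (M : ℂ) / (W : ℂ) := by push_cast; rfl
      rw [e] at key
      rw [key]
  · by_cases hd : (W : ℤ) ∣ h
    · simp [hd]
    · simp only [if_neg hd]
      exact integrable_fourierChar_mul_bumpC_scaled hM hWr _ _

end Drappeau2017

end Literature.NumberTheory.Sieve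

end
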